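import Summits.CriticalPhenomena.PercolationContinuityZ3.Theorems.PercNearOneGluingNoHeavyLowerTailSectorTransfer
import Summits.CriticalPhenomena.PercolationContinuityZ3.Theorems.PercNearOneGluingNoHeavyLowerTailSectorPairTransfer
import HarnessLib

/-!
# `NoHeavyLowerTail` (stmt-CriticalPhenomena-4575) — three relays: sector II from the WITHIN-PAIR order `τ₃ ≤ τ₂` and the symmetric
# hypothesis-free row `Σmin`; assembly of KN Q7@3 at the designated minimiser (gen 6, `nh-dp-commonrelay`)

Support file (`--supports stmt-CriticalPhenomena-4575`); no definitions, no named facts, no sorries.  Setting and notation of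
`…SectorTransfer` / `…SectorPairTransfer`: observer `o`, target `b`, relays `a₁, a₂, a₃`, `N₁ = {a₁ ↮ a₂, a₃}`, `D = {a₃ ↮ a₁, a₂}`,
`M` = all separated, `P₁ = μ(N₁)`, `P_M = μ(M)`, `A₁ = μ(N₁ ∩ {a₁↔o})`, `Mo₁ = μ(M ∩ {a₁↔o})`, `m_T = μ(C(b) ∩ A = T)`,
`m₂ᴹ = μ(M ∩ {a₂↔b})`, `m₃ᴹ = μ(M ∩ {a₃↔b})`, `τᵢ = μ(aᵢ↔b)`.  The sector-II quantity `II = T₁ − U₁` is symmetric under `a₂ ↔ a₃`.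
* `sector_delta_le_m3M_pair` (PROVED): `τ₃ ≤ τ₂ ⟹ m₃ ≤ m₁₂ + m₃ᴹ` (`sector_delta_le` at `(a₂, a₁)`).
* `sectorII_of_sigmaMin`: the sector inequality (II) (conclusion of the registered `stub_sectorII`) from `τ₃ ≤ τ₂` ALONE and the
  hypothesis-free, `a₂ ↔ a₃`-symmetric row `Σmin : (P₁ Mo₁ − P_M A₁) · min(m₂ᴹ, m₃ᴹ) ≤ P_M (P₁ (T₁−U₁) − A₁ (m₁−m₂₃))`
  ("KN's BHK slack of sector II is at least `(ψ₁ − φ₁) · min(μ(M, a₂↔b), μ(M, a₃↔b))`"; conjectural — 0 violations on the complete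
  ttrl2 `sigma1` hard-corner bank (36 666 labellings) where the asymmetric `Σ₁`/`T1b`/`Ξ₁` die, memo RESIDUAL-gen6.md in
  run/shared/lean/prim/prim-nh-dp-commonrelay/).  The one-sided (II) with `τ₃ ≤ τ₁` alone is FALSE (`…SectorOneSidedCex`).
* `preFKG3_of_claimI_sigmaMin`: pre-FKG (3) at the designated minimiser `a₃` (KN Question 7 at `|A| = 3`, first open rung of `stub_dcone`)
  ⟸ (I) = CLAIM-I-ψ (`stub_sectorClaimIpsi`) ∧ `Σmin(a₁; a₂,a₃)` ∧ `Σmin(a₂; a₁,a₃)`; the two-sided hypothesis `τ₃ ≤ τ₁, τ₂` is used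
  only through the Lemma-3 transfers (sector II: `τ₃ ≤ τ₂`; sector III: `τ₃ ≤ τ₁`).
[cite: KozmaNitzan2024, Lemma 3 (pp. 6–7), Theorem 2 (pp. 8–9), Question 7 (p. 36); VandenbergHaggstromKahn2005, Thms. 1.3–1.4]
-/

namespace Summit.CriticalPhenomena.PercolationContinuityZ3.Theorems

open MeasureTheory Set Literature.Probability.LatticeModels Literature.Probability.Percolation

noncomputable section
open Classical

variable {n : ℕ}

/-- **`Δ ≤ m₃ᴹ` under `τ₃ ≤ τ₂` (PROVED):** `m₃ ≤ m₁₂ + μ(M ∩ {a₃↔b})` — the transfer `sector_delta_le` of `…SectorTransfer`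
with the roles of `a₁, a₂` exchanged (KN Lemma 3(i) with the increasing event `{a₁↔a₂}` of the cluster of `a₂`).
[cite: KozmaNitzan2024, Lemma 3(i) (pp. 6–7)] -/
theorem sector_delta_le_m3M_pair (w : Sym2 (Fin n) → unitInterval) (b a₁ a₂ a₃ : Fin n) (h23 : a₂ ≠ a₃)
    (hτ : (prodBernoulli w).real (openConn a₃ b) ≤ (prodBernoulli w).real (openConn a₂ b)) :
    (prodBernoulli w).real ((openConn a₁ a₃)ᶜ ∩ (openConn a₂ a₃)ᶜ ∩ openConn a₃ b) ≤
      (prodBernoulli w).real ((openConn a₁ a₃)ᶜ ∩ (openConn a₂ a₃)ᶜ ∩ (openConn a₁ b ∩ openConn a₂ b)) +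
        (prodBernoulli w).real ((openConn a₁ a₂)ᶜ ∩ (openConn a₁ a₃)ᶜ ∩ (openConn a₂ a₃)ᶜ ∩ openConn a₃ b) := by
  have key := sector_delta_le w b a₂ a₁ a₃ h23 hτ
  have eN : ((openConn a₂ a₃)ᶜ ∩ (openConn a₁ a₃)ᶜ : Set (BondConfig (Fin n))) = (openConn a₁ a₃)ᶜ ∩ (openConn a₂ a₃)ᶜ :=
    Set.inter_comm _ _
  have eB : (openConn a₂ b ∩ openConn a₁ b : Set (BondConfig (Fin n))) = openConn a₁ b ∩ openConn a₂ b :=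
    Set.inter_comm _ _
  have eM : ((openConn a₂ a₁)ᶜ ∩ (openConn a₂ a₃)ᶜ ∩ (openConn a₁ a₃)ᶜ : Set (BondConfig (Fin n))) =
      (openConn a₁ a₂)ᶜ ∩ (openConn a₁ a₃)ᶜ ∩ (openConn a₂ a₃)ᶜ := by
    rw [knThm2_openConn_comm a₂ a₁, Set.inter_assoc, Set.inter_comm ((openConn a₂ a₃)ᶜ), ← Set.inter_assoc]
  rw [eN, eB, eM] at key
  exact key

/-! ### `Ξmin ⟹ Σmin` (the within-cluster credit `s₄A ≥ 0`, BHK Thm 1.3) -/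

/-- **`Σmin` from `Ξmin`.**  `Ξmin` is the B-half form `(P₁ Mo₁ − P_M A₁) · min(m₂ᴹ, m₃ᴹ) ≤ P_M (A₁ m₂₃ − P₁ U₁)`
("the cross-cluster BHK slack `s₄B = φ₁ m₂₃ − U₁` alone is at least `(ψ₁ − φ₁) min(m₂ᴹ, m₃ᴹ)`", `m₂₃ = μ(N₁ ∩ {a₂↔b} ∩ {a₃↔b})`,
`U₁ = μ(N₁ ∩ {a₁↔o} ∩ {a₂↔b} ∩ {a₃↔b})`); adding the within-cluster slack `P₁ T₁ − A₁ m₁ ≥ 0` (BHK Thm 1.3 on `N₁` for the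
increasing events `{a₁↔o}`, `{a₁↔b}` of `C(a₁)`, set form `stub_bhkSets.1`) gives `Σmin`.  Equivalent one-set form of `Ξmin` (memo §4):
`Cov_π(1{o∈Γ}, u) ≤ min_j μ(b↔a_j | M) · Cov_π(1{o∈Γ}, η)` for `Γ = C(a₁)` under `μ(· | N₁)`, `u(Γ) = μ_{G∖Γ}(a₂↔a₃↔b)`, `η(Γ) = μ_{G∖Γ}(a₂↔a₃)`.
[this file; cite: VandenbergHaggstromKahn2005, Thm. 1.3] -/
theorem sigmaMin_of_xiMin (w : Sym2 (Fin n) → unitInterval) (o b a₁ a₂ a₃ : Fin n) (h12 : a₁ ≠ a₂) (h13 : a₁ ≠ a₃)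
    (hXi : ((prodBernoulli w).real ((openConn a₁ a₂)ᶜ ∩ (openConn a₁ a₃)ᶜ : Set (BondConfig (Fin n))) *
              (prodBernoulli w).real ((openConn a₁ a₂)ᶜ ∩ (openConn a₁ a₃)ᶜ ∩ (openConn a₂ a₃)ᶜ ∩ openConn a₁ o) -
            (prodBernoulli w).real ((openConn a₁ a₂)ᶜ ∩ (openConn a₁ a₃)ᶜ ∩ (openConn a₂ a₃)ᶜ : Set (BondConfig (Fin n))) *
              (prodBernoulli w).real ((openConn a₁ a₂)ᶜ ∩ (openConn a₁ a₃)ᶜ ∩ openConn a₁ o)) *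
          min ((prodBernoulli w).real ((openConn a₁ a₂)ᶜ ∩ (openConn a₁ a₃)ᶜ ∩ (openConn a₂ a₃)ᶜ ∩ openConn a₂ b))
            ((prodBernoulli w).real ((openConn a₁ a₂)ᶜ ∩ (openConn a₁ a₃)ᶜ ∩ (openConn a₂ a₃)ᶜ ∩ openConn a₃ b)) ≤
        (prodBernoulli w).real ((openConn a₁ a₂)ᶜ ∩ (openConn a₁ a₃)ᶜ ∩ (openConn a₂ a₃)ᶜ : Set (BondConfig (Fin n))) *
          ((prodBernoulli w).real ((openConn a₁ a₂)ᶜ ∩ (openConn a₁ a₃)ᶜ ∩ openConn a₁ o) *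
              (prodBernoulli w).real ((openConn a₁ a₂)ᶜ ∩ (openConn a₁ a₃)ᶜ ∩ (openConn a₂ b ∩ openConn a₃ b)) -
            (prodBernoulli w).real ((openConn a₁ a₂)ᶜ ∩ (openConn a₁ a₃)ᶜ : Set (BondConfig (Fin n))) *
              (prodBernoulli w).real ((openConn a₁ a₂)ᶜ ∩ (openConn a₁ a₃)ᶜ ∩ (openConn a₁ o ∩ (openConn a₂ b ∩ openConn a₃ b))))) :
    ((prodBernoulli w).real ((openConn a₁ a₂)ᶜ ∩ (openConn a₁ a₃)ᶜ : Set (BondConfig (Fin n))) *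
          (prodBernoulli w).real ((openConn a₁ a₂)ᶜ ∩ (openConn a₁ a₃)ᶜ ∩ (openConn a₂ a₃)ᶜ ∩ openConn a₁ o) -
        (prodBernoulli w).real ((openConn a₁ a₂)ᶜ ∩ (openConn a₁ a₃)ᶜ ∩ (openConn a₂ a₃)ᶜ : Set (BondConfig (Fin n))) *
          (prodBernoulli w).real ((openConn a₁ a₂)ᶜ ∩ (openConn a₁ a₃)ᶜ ∩ openConn a₁ o)) *
        min ((prodBernoulli w).real ((openConn a₁ a₂)ᶜ ∩ (openConn a₁ a₃)ᶜ ∩ (openConn a₂ a₃)ᶜ ∩ openConn a₂ b))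
          ((prodBernoulli w).real ((openConn a₁ a₂)ᶜ ∩ (openConn a₁ a₃)ᶜ ∩ (openConn a₂ a₃)ᶜ ∩ openConn a₃ b)) ≤
      (prodBernoulli w).real ((openConn a₁ a₂)ᶜ ∩ (openConn a₁ a₃)ᶜ ∩ (openConn a₂ a₃)ᶜ : Set (BondConfig (Fin n))) *
        ((prodBernoulli w).real ((openConn a₁ a₂)ᶜ ∩ (openConn a₁ a₃)ᶜ : Set (BondConfig (Fin n))) *
            ((prodBernoulli w).real ((openConn a₁ a₂)ᶜ ∩ (openConn a₁ a₃)ᶜ ∩ (openConn a₁ o ∩ openConn a₁ b)) -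
              (prodBernoulli w).real ((openConn a₁ a₂)ᶜ ∩ (openConn a₁ a₃)ᶜ ∩ (openConn a₁ o ∩ (openConn a₂ b ∩ openConn a₃ b)))) -
          (prodBernoulli w).real ((openConn a₁ a₂)ᶜ ∩ (openConn a₁ a₃)ᶜ ∩ openConn a₁ o) *
            ((prodBernoulli w).real ((openConn a₁ a₂)ᶜ ∩ (openConn a₁ a₃)ᶜ ∩ openConn a₁ b) -
              (prodBernoulli w).real ((openConn a₁ a₂)ᶜ ∩ (openConn a₁ a₃)ᶜ ∩ (openConn a₂ b ∩ openConn a₃ b)))) := by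
  have i3 := knThm2_bhkOne stub_bhkSets.1 w {a₁} ({a₂, a₃} : Set (Fin n)) o b (by simp [h12, h13])
  rw [knThm2_sep_single_set, Finset.set_biUnion_singleton, Finset.set_biInter_singleton] at i3
  have hPM : 0 ≤ (prodBernoulli w).real ((openConn a₁ a₂)ᶜ ∩ (openConn a₁ a₃)ᶜ ∩ (openConn a₂ a₃)ᶜ : Set (BondConfig (Fin n))) :=
    measureReal_nonneg
  have aux := mul_nonneg hPM (sub_nonneg.2 i3)
  nlinarith [aux, hXi]

/-! ### Sector II from the within-pair order and `Σmin` -/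

/-- **(II) from `τ₃ ≤ τ₂` and the hypothesis-free symmetric row `Σmin`.**  `Σmin`, division-free:
`(P₁ Mo₁ − P_M A₁) · min(μ(M ∩ {a₂↔b}), μ(M ∩ {a₃↔b})) ≤ P_M · (P₁ (T₁ − U₁) − A₁ (m₁ − m₂₃))` (KN's BHK slack of sector II is at
least `(ψ₁ − φ₁) min(m₂ᴹ, m₃ᴹ)`; symmetric under `a₂ ↔ a₃` like `II` itself).  With `sector_delta_le_m2M`, `sector_delta_le_m3M_pair`,
`sector_psi_ge_phi` and the identity `knThm2_tau_sub` this gives the sector inequality (II) — using ONLY the within-pair order `τ₃ ≤ τ₂`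
(no comparison with `τ₁`).  [this file; cite: KozmaNitzan2024, Theorem 2 (pp. 8–9)] -/
theorem sectorII_of_sigmaMin (w : Sym2 (Fin n) → unitInterval) (o b a₁ a₂ a₃ : Fin n) (h12 : a₁ ≠ a₂) (h13 : a₁ ≠ a₃)
    (h23 : a₂ ≠ a₃)
    (hτ₂ : (prodBernoulli w).real (openConn a₃ b) ≤ (prodBernoulli w).real (openConn a₂ b))
    (hSig : ((prodBernoulli w).real ((openConn a₁ a₂)ᶜ ∩ (openConn a₁ a₃)ᶜ : Set (BondConfig (Fin n))) *
              (prodBernoulli w).real ((openConn a₁ a₂)ᶜ ∩ (openConn a₁ a₃)ᶜ ∩ (openConn a₂ a₃)ᶜ ∩ openConn a₁ o) -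
            (prodBernoulli w).real ((openConn a₁ a₂)ᶜ ∩ (openConn a₁ a₃)ᶜ ∩ (openConn a₂ a₃)ᶜ : Set (BondConfig (Fin n))) *
              (prodBernoulli w).real ((openConn a₁ a₂)ᶜ ∩ (openConn a₁ a₃)ᶜ ∩ openConn a₁ o)) *
          min ((prodBernoulli w).real ((openConn a₁ a₂)ᶜ ∩ (openConn a₁ a₃)ᶜ ∩ (openConn a₂ a₃)ᶜ ∩ openConn a₂ b))
            ((prodBernoulli w).real ((openConn a₁ a₂)ᶜ ∩ (openConn a₁ a₃)ᶜ ∩ (openConn a₂ a₃)ᶜ ∩ openConn a₃ b)) ≤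
        (prodBernoulli w).real ((openConn a₁ a₂)ᶜ ∩ (openConn a₁ a₃)ᶜ ∩ (openConn a₂ a₃)ᶜ : Set (BondConfig (Fin n))) *
          ((prodBernoulli w).real ((openConn a₁ a₂)ᶜ ∩ (openConn a₁ a₃)ᶜ : Set (BondConfig (Fin n))) *
              ((prodBernoulli w).real ((openConn a₁ a₂)ᶜ ∩ (openConn a₁ a₃)ᶜ ∩ (openConn a₁ o ∩ openConn a₁ b)) -
                (prodBernoulli w).real ((openConn a₁ a₂)ᶜ ∩ (openConn a₁ a₃)ᶜ ∩ (openConn a₁ o ∩ (openConn a₂ b ∩ openConn a₃ b)))) -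
            (prodBernoulli w).real ((openConn a₁ a₂)ᶜ ∩ (openConn a₁ a₃)ᶜ ∩ openConn a₁ o) *
              ((prodBernoulli w).real ((openConn a₁ a₂)ᶜ ∩ (openConn a₁ a₃)ᶜ ∩ openConn a₁ b) -
                (prodBernoulli w).real ((openConn a₁ a₂)ᶜ ∩ (openConn a₁ a₃)ᶜ ∩ (openConn a₂ b ∩ openConn a₃ b))))) :
    (prodBernoulli w).real ((openConn a₁ a₂)ᶜ ∩ (openConn a₁ a₃)ᶜ ∩ (openConn a₂ a₃)ᶜ : Set (BondConfig (Fin n))) *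
          (prodBernoulli w).real ((openConn a₁ a₂)ᶜ ∩ (openConn a₁ a₃)ᶜ ∩ openConn a₁ o) *
          ((prodBernoulli w).real (openConn a₁ b) - (prodBernoulli w).real (openConn a₃ b)) +
        (prodBernoulli w).real ((openConn a₁ a₂)ᶜ ∩ (openConn a₁ a₃)ᶜ : Set (BondConfig (Fin n))) *
          (prodBernoulli w).real ((openConn a₁ a₂)ᶜ ∩ (openConn a₁ a₃)ᶜ ∩ (openConn a₂ a₃)ᶜ ∩ openConn a₁ o) *
          ((prodBernoulli w).real ((openConn a₁ a₃)ᶜ ∩ (openConn a₂ a₃)ᶜ ∩ openConn a₃ b) -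
            (prodBernoulli w).real ((openConn a₁ a₃)ᶜ ∩ (openConn a₂ a₃)ᶜ ∩ (openConn a₁ b ∩ openConn a₂ b))) ≤
      (prodBernoulli w).real ((openConn a₁ a₂)ᶜ ∩ (openConn a₁ a₃)ᶜ : Set (BondConfig (Fin n))) *
        (prodBernoulli w).real ((openConn a₁ a₂)ᶜ ∩ (openConn a₁ a₃)ᶜ ∩ (openConn a₂ a₃)ᶜ : Set (BondConfig (Fin n))) *
        ((prodBernoulli w).real ((openConn a₁ a₂)ᶜ ∩ (openConn a₁ a₃)ᶜ ∩ (openConn a₁ o ∩ openConn a₁ b)) -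
          (prodBernoulli w).real ((openConn a₁ a₂)ᶜ ∩ (openConn a₁ a₃)ᶜ ∩ (openConn a₁ o ∩ (openConn a₂ b ∩ openConn a₃ b)))) :=
  sectorII_pair_arith hSig (knThm2_tau_sub w b a₁ a₂ a₃) (sector_delta_le_m2M w b a₁ a₂ a₃ h23 hτ₂)
    (sector_delta_le_m3M_pair w b a₁ a₂ a₃ h23 hτ₂) (sector_psi_ge_phi w o a₁ a₂ a₃ h12 h13)

/-- **Pre-FKG (3) at the designated minimiser `a₃` ⟸ CLAIM-I-ψ ∧ `Σmin(a₁; a₂,a₃)` ∧ `Σmin(a₂; a₁,a₃)`.**  Relays pairwise distinct,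
`τ₃ ≤ τ₁`, `τ₃ ≤ τ₂`, `μ(M) > 0`.  The two-sided minimiser hypothesis enters ONLY through the Lemma-3 transfers: sector II
(`sectorII_of_sigmaMin` at `(a₁; a₂, a₃)`) uses `τ₃ ≤ τ₂`, sector III (the same at `(a₂; a₁, a₃)`) uses `τ₃ ≤ τ₁`; the rows `Σmin` are
hypothesis-free.  Assembly by `preFKG3_of_sectorTransfer`. [this file; cite: KozmaNitzan2024, Theorem 2 (pp. 8–9), Question 7 (p. 36)] -/
theorem preFKG3_of_claimI_sigmaMin (w : Sym2 (Fin n) → unitInterval) (o b a₁ a₂ a₃ : Fin n)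
    (h12 : a₁ ≠ a₂) (h13 : a₁ ≠ a₃) (h23 : a₂ ≠ a₃)
    (hM : 0 < (prodBernoulli w).real ((openConn a₁ a₂)ᶜ ∩ (openConn a₁ a₃)ᶜ ∩ (openConn a₂ a₃)ᶜ : Set (BondConfig (Fin n))))
    (hτ₁ : (prodBernoulli w).real (openConn a₃ b) ≤ (prodBernoulli w).real (openConn a₁ b))
    (hτ₂ : (prodBernoulli w).real (openConn a₃ b) ≤ (prodBernoulli w).real (openConn a₂ b))
    (hI : ((prodBernoulli w).real ((openConn a₁ a₂)ᶜ ∩ (openConn a₁ a₃)ᶜ ∩ (openConn a₂ a₃)ᶜ ∩ openConn a₁ o) +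
            (prodBernoulli w).real ((openConn a₁ a₂)ᶜ ∩ (openConn a₁ a₃)ᶜ ∩ (openConn a₂ a₃)ᶜ ∩ openConn a₂ o)) *
          ((prodBernoulli w).real ((openConn a₁ a₃)ᶜ ∩ (openConn a₂ a₃)ᶜ ∩ (openConn a₁ b ∩ openConn a₂ b)) -
            (prodBernoulli w).real ((openConn a₁ a₃)ᶜ ∩ (openConn a₂ a₃)ᶜ ∩ openConn a₃ b)) ≤
        (prodBernoulli w).real ((openConn a₁ a₂)ᶜ ∩ (openConn a₁ a₃)ᶜ ∩ (openConn a₂ a₃)ᶜ : Set (BondConfig (Fin n))) *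
          ((prodBernoulli w).real ((openConn a₁ a₃)ᶜ ∩ (openConn a₂ a₃)ᶜ ∩ ((openConn a₁ o ∪ openConn a₂ o) ∩ (openConn a₁ b ∩ openConn a₂ b))) -
            (prodBernoulli w).real ((openConn a₁ a₃)ᶜ ∩ (openConn a₂ a₃)ᶜ ∩ ((openConn a₁ o ∪ openConn a₂ o) ∩ openConn a₃ b))))
    (hSig1 : ((prodBernoulli w).real ((openConn a₁ a₂)ᶜ ∩ (openConn a₁ a₃)ᶜ : Set (BondConfig (Fin n))) *
              (prodBernoulli w).real ((openConn a₁ a₂)ᶜ ∩ (openConn a₁ a₃)ᶜ ∩ (openConn a₂ a₃)ᶜ ∩ openConn a₁ o) -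
            (prodBernoulli w).real ((openConn a₁ a₂)ᶜ ∩ (openConn a₁ a₃)ᶜ ∩ (openConn a₂ a₃)ᶜ : Set (BondConfig (Fin n))) *
              (prodBernoulli w).real ((openConn a₁ a₂)ᶜ ∩ (openConn a₁ a₃)ᶜ ∩ openConn a₁ o)) *
          min ((prodBernoulli w).real ((openConn a₁ a₂)ᶜ ∩ (openConn a₁ a₃)ᶜ ∩ (openConn a₂ a₃)ᶜ ∩ openConn a₂ b))
            ((prodBernoulli w).real ((openConn a₁ a₂)ᶜ ∩ (openConn a₁ a₃)ᶜ ∩ (openConn a₂ a₃)ᶜ ∩ openConn a₃ b)) ≤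
        (prodBernoulli w).real ((openConn a₁ a₂)ᶜ ∩ (openConn a₁ a₃)ᶜ ∩ (openConn a₂ a₃)ᶜ : Set (BondConfig (Fin n))) *
          ((prodBernoulli w).real ((openConn a₁ a₂)ᶜ ∩ (openConn a₁ a₃)ᶜ : Set (BondConfig (Fin n))) *
              ((prodBernoulli w).real ((openConn a₁ a₂)ᶜ ∩ (openConn a₁ a₃)ᶜ ∩ (openConn a₁ o ∩ openConn a₁ b)) -
                (prodBernoulli w).real ((openConn a₁ a₂)ᶜ ∩ (openConn a₁ a₃)ᶜ ∩ (openConn a₁ o ∩ (openConn a₂ b ∩ openConn a₃ b)))) -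
            (prodBernoulli w).real ((openConn a₁ a₂)ᶜ ∩ (openConn a₁ a₃)ᶜ ∩ openConn a₁ o) *
              ((prodBernoulli w).real ((openConn a₁ a₂)ᶜ ∩ (openConn a₁ a₃)ᶜ ∩ openConn a₁ b) -
                (prodBernoulli w).real ((openConn a₁ a₂)ᶜ ∩ (openConn a₁ a₃)ᶜ ∩ (openConn a₂ b ∩ openConn a₃ b)))))
    (hSig2 : ((prodBernoulli w).real ((openConn a₂ a₁)ᶜ ∩ (openConn a₂ a₃)ᶜ : Set (BondConfig (Fin n))) *
              (prodBernoulli w).real ((openConn a₁ a₂)ᶜ ∩ (openConn a₁ a₃)ᶜ ∩ (openConn a₂ a₃)ᶜ ∩ openConn a₂ o) -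
            (prodBernoulli w).real ((openConn a₁ a₂)ᶜ ∩ (openConn a₁ a₃)ᶜ ∩ (openConn a₂ a₃)ᶜ : Set (BondConfig (Fin n))) *
              (prodBernoulli w).real ((openConn a₂ a₁)ᶜ ∩ (openConn a₂ a₃)ᶜ ∩ openConn a₂ o)) *
          min ((prodBernoulli w).real ((openConn a₁ a₂)ᶜ ∩ (openConn a₁ a₃)ᶜ ∩ (openConn a₂ a₃)ᶜ ∩ openConn a₁ b))
            ((prodBernoulli w).real ((openConn a₁ a₂)ᶜ ∩ (openConn a₁ a₃)ᶜ ∩ (openConn a₂ a₃)ᶜ ∩ openConn a₃ b)) ≤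
        (prodBernoulli w).real ((openConn a₁ a₂)ᶜ ∩ (openConn a₁ a₃)ᶜ ∩ (openConn a₂ a₃)ᶜ : Set (BondConfig (Fin n))) *
          ((prodBernoulli w).real ((openConn a₂ a₁)ᶜ ∩ (openConn a₂ a₃)ᶜ : Set (BondConfig (Fin n))) *
              ((prodBernoulli w).real ((openConn a₂ a₁)ᶜ ∩ (openConn a₂ a₃)ᶜ ∩ (openConn a₂ o ∩ openConn a₂ b)) -
                (prodBernoulli w).real ((openConn a₂ a₁)ᶜ ∩ (openConn a₂ a₃)ᶜ ∩ (openConn a₂ o ∩ (openConn a₁ b ∩ openConn a₃ b)))) -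
            (prodBernoulli w).real ((openConn a₂ a₁)ᶜ ∩ (openConn a₂ a₃)ᶜ ∩ openConn a₂ o) *
              ((prodBernoulli w).real ((openConn a₂ a₁)ᶜ ∩ (openConn a₂ a₃)ᶜ ∩ openConn a₂ b) -
                (prodBernoulli w).real ((openConn a₂ a₁)ᶜ ∩ (openConn a₂ a₃)ᶜ ∩ (openConn a₁ b ∩ openConn a₃ b))))) :
    (prodBernoulli w).real ((openConn o a₁ ∪ openConn o a₂ ∪ openConn o a₃) ∩ openConn a₃ b) ≤
      (prodBernoulli w).real ((openConn o a₁ ∪ openConn o a₂ ∪ openConn o a₃) ∩ openConn o b) := by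
  have hII := sectorII_of_sigmaMin w o b a₁ a₂ a₃ h12 h13 h23 hτ₂ hSig1
  have eM : ((openConn a₂ a₁)ᶜ ∩ (openConn a₂ a₃)ᶜ ∩ (openConn a₁ a₃)ᶜ : Set (BondConfig (Fin n))) =
      (openConn a₁ a₂)ᶜ ∩ (openConn a₁ a₃)ᶜ ∩ (openConn a₂ a₃)ᶜ := by
    rw [knThm2_openConn_comm a₂ a₁, Set.inter_assoc, Set.inter_comm ((openConn a₂ a₃)ᶜ), ← Set.inter_assoc]
  have eN : ((openConn a₂ a₃)ᶜ ∩ (openConn a₁ a₃)ᶜ : Set (BondConfig (Fin n))) = (openConn a₁ a₃)ᶜ ∩ (openConn a₂ a₃)ᶜ :=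
    Set.inter_comm _ _
  have eB : (openConn a₂ b ∩ openConn a₁ b : Set (BondConfig (Fin n))) = openConn a₁ b ∩ openConn a₂ b :=
    Set.inter_comm _ _
  have hIII := sectorII_of_sigmaMin w o b a₂ a₁ a₃ h12.symm h23 h13 hτ₁ (by rw [eM]; exact hSig2)
  rw [eM, eN, eB] at hIII
  exact preFKG3_of_sectorTransfer w o b a₁ a₂ a₃ hM hτ₁ hτ₂ hI hII hIII


/-! ### The rung from REGISTERED statements taken verbatim: (I) with either `stub_sectorIIPair` or the hypothesis-free `Ξmin` -/

/-- **KN Q7 at three relays from the registered stubs (I) = `stub_sectorClaimIpsi` and (II)@pair = `stub_sectorIIPair`** (the sector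
inequality (II) under the within-pair order `τ₃ ≤ τ₂` only), both taken VERBATIM as hypotheses: for pairwise distinct `o, b, a₁, a₂, a₃` with
`τ₃ ≤ τ₁, τ₂` and `μ(all three relays separated) > 0`, `μ(o↔A, a₃↔b) ≤ μ(o↔A, o↔b)`.  Sector II uses the stub at `(a₁; a₂, a₃)` with `τ₃ ≤ τ₂`,
sector III at `(a₂; a₁, a₃)` with `τ₃ ≤ τ₁`. [this file; cite: KozmaNitzan2024, Question 7 (p. 36)] -/
theorem preFKG3_of_sectorPairStubs
    (hI : ∀ (n : ℕ) (w : Sym2 (Fin n) → unitInterval) (o b a₁ a₂ a₃ : Fin n), a₁ ≠ a₂ → a₁ ≠ a₃ → a₂ ≠ a₃ → o ≠ a₁ → o ≠ a₂ → o ≠ a₃ → b ≠ a₁ → b ≠ a₂ → b ≠ a₃ → o ≠ b → (prodBernoulli w).real (openConn a₃ b) ≤ (prodBernoulli w).real (openConn a₁ b) → (prodBernoulli w).real (openConn a₃ b) ≤ (prodBernoulli w).real (openConn a₂ b) → ((prodBernoulli w).real ((openConn a₁ a₂)ᶜ ∩ (openConn a₁ a₃)ᶜ ∩ (openConn a₂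 a₃)ᶜ ∩ openConn a₁ o) + (prodBernoulli w).real ((openConn a₁ a₂)ᶜ ∩ (openConn a₁ a₃)ᶜ ∩ (openConn a₂ a₃)ᶜ ∩ openConn a₂ o)) * ((prodBernoulli w).real ((openConn a₁ a₃)ᶜ ∩ (openConn a₂ a₃)ᶜ ∩ (openConn a₁ b ∩ openConn a₂ b)) - (prodBernoulli w).real ((openConn a₁ a₃)ᶜ ∩ (openConn a₂ a₃)ᶜ ∩ openConn a₃ b)) ≤ (prodBernoulli w).real ((openConn a₁ a₂)ᶜ ∩ (openConn a₁ a₃)ᶜ ∩ (openConn a₂ a₃)ᶜ : Set (BondConfig (Fin n))) * ((prodBernoulli w).real ((openConn a₁ a₃)ᶜ ∩ (openConn a₂ a₃)ᶜ ∩ ((openConn a₁ o ∪ openConn a₂ o) ∩ (openConn a₁ b ∩ openConn a₂ b))) - (prodBernoulli w).real ((openConn a₁ a₃)ᶜ ∩ (openConn a₂ a₃)ᶜ ∩ ((openConn a₁ o ∪ openConn a₂ o) ∩ openConn a₃ b))))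
    (hII : ∀ (n : ℕ) (w : Sym2 (Fin n) → unitInterval) (o b a₁ a₂ a₃ : Fin n), a₁ ≠ a₂ → a₁ ≠ a₃ → a₂ ≠ a₃ → o ≠ a₁ → o ≠ a₂ → o ≠ a₃ → b ≠ a₁ → b ≠ a₂ → b ≠ a₃ → o ≠ b → (prodBernoulli w).real (openConn a₃ b) ≤ (prodBernoulli w).real (openConn a₂ b) → (prodBernoulli w).real ((openConn a₁ a₂)ᶜ ∩ (openConn a₁ a₃)ᶜ ∩ (openConn a₂ a₃)ᶜ : Set (BondConfig (Fin n))) * (prodBernoulli w).real ((openConn a₁ a₂)ᶜ ∩ (openConn a₁ a₃)ᶜ ∩ openConn a₁ o) * ((prodBernoulli w).real (openConn a₁ b) - (prodBernoulli w).real (openConn a₃ b)) + (prodBernoulli w).real ((openConn a₁ a₂)ᶜ ∩ (openConn a₁ a₃)ᶜ : Set (BondConfig (Fin n))) * (prodBernoulli w).real ((openConn a₁ a₂)ᶜ ∩ (openConn a₁ a₃)ᶜ ∩ (openConn a₂ a₃)ᶜ ∩ openConn a₁ o) * ((prodBernoulli w).real ((openConn a₁ a₃)ᶜ ∩ (openConn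 a₂ a₃)ᶜ ∩ openConn a₃ b) - (prodBernoulli w).real ((openConn a₁ a₃)ᶜ ∩ (openConn a₂ a₃)ᶜ ∩ (openConn a₁ b ∩ openConn a₂ b))) ≤ (prodBernoulli w).real ((openConn a₁ a₂)ᶜ ∩ (openConn a₁ a₃)ᶜ : Set (BondConfig (Fin n))) * (prodBernoulli w).real ((openConn a₁ a₂)ᶜ ∩ (openConn a₁ a₃)ᶜ ∩ (openConn a₂ a₃)ᶜ : Set (BondConfig (Fin n))) * ((prodBernoulli w).real ((openConn a₁ a₂)ᶜ ∩ (openConn a₁ a₃)ᶜ ∩ (openConn a₁ o ∩ openConn a₁ b)) - (prodBernoulli w).real ((openConn a₁ a₂)ᶜ ∩ (openConn a₁ a₃)ᶜ ∩ (openConn a₁ o ∩ (openConn a₂ b ∩ openConn a₃ b)))))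
    {n : ℕ} (w : Sym2 (Fin n) → unitInterval) (o b a₁ a₂ a₃ : Fin n)
    (h12 : a₁ ≠ a₂) (h13 : a₁ ≠ a₃) (h23 : a₂ ≠ a₃) (ho1 : o ≠ a₁) (ho2 : o ≠ a₂) (ho3 : o ≠ a₃)
    (hb1 : b ≠ a₁) (hb2 : b ≠ a₂) (hb3 : b ≠ a₃) (hob : o ≠ b)
    (hM : 0 < (prodBernoulli w).real ((openConn a₁ a₂)ᶜ ∩ (openConn a₁ a₃)ᶜ ∩ (openConn a₂ a₃)ᶜ : Set (BondConfig (Fin n))))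
    (hτ₁ : (prodBernoulli w).real (openConn a₃ b) ≤ (prodBernoulli w).real (openConn a₁ b))
    (hτ₂ : (prodBernoulli w).real (openConn a₃ b) ≤ (prodBernoulli w).real (openConn a₂ b)) :
    (prodBernoulli w).real ((openConn o a₁ ∪ openConn o a₂ ∪ openConn o a₃) ∩ openConn a₃ b) ≤
      (prodBernoulli w).real ((openConn o a₁ ∪ openConn o a₂ ∪ openConn o a₃) ∩ openConn o b) := by
  have h2 := hII n w o b a₁ a₂ a₃ h12 h13 h23 ho1 ho2 ho3 hb1 hb2 hb3 hob hτ₂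
  have h3 := hII n w o b a₂ a₁ a₃ h12.symm h23 h13 ho2 ho1 ho3 hb2 hb1 hb3 hob hτ₁
  have eM : ((openConn a₂ a₁)ᶜ ∩ (openConn a₂ a₃)ᶜ ∩ (openConn a₁ a₃)ᶜ : Set (BondConfig (Fin n))) =
      (openConn a₁ a₂)ᶜ ∩ (openConn a₁ a₃)ᶜ ∩ (openConn a₂ a₃)ᶜ := by
    rw [knThm2_openConn_comm a₂ a₁, Set.inter_assoc, Set.inter_comm ((openConn a₂ a₃)ᶜ), ← Set.inter_assoc]
  have eN : ((openConn a₂ a₃)ᶜ ∩ (openConn a₁ a₃)ᶜ : Set (BondConfig (Fin n))) = (openConn a₁ a₃)ᶜ ∩ (openConn a₂ a₃)ᶜ :=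
    Set.inter_comm _ _
  have eB : (openConn a₂ b ∩ openConn a₁ b : Set (BondConfig (Fin n))) = openConn a₁ b ∩ openConn a₂ b :=
    Set.inter_comm _ _
  rw [eM, eN, eB] at h3
  exact preFKG3_of_sectorTransfer w o b a₁ a₂ a₃ hM hτ₁ hτ₂
    (hI n w o b a₁ a₂ a₃ h12 h13 h23 ho1 ho2 ho3 hb1 hb2 hb3 hob hτ₁ hτ₂) h2 h3

/-- **KN Q7 at three relays from (I) = `stub_sectorClaimIpsi` and the HYPOTHESIS-FREE symmetric row `Ξmin` (`stub_xiMinThreeRelays`)**, both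
verbatim: `Ξmin ⟹ Σmin` (`sigmaMin_of_xiMin`) at `(a₁; a₂, a₃)` and at `(a₂; a₁, a₃)`, then `preFKG3_of_claimI_sigmaMin` (which spends `τ₃ ≤ τ₂`
on sector II and `τ₃ ≤ τ₁` on sector III). [this file; cite: KozmaNitzan2024, Question 7 (p. 36)] -/
theorem preFKG3_of_claimI_xiMinStub
    (hI : ∀ (n : ℕ) (w : Sym2 (Fin n) → unitInterval) (o b a₁ a₂ a₃ : Fin n), a₁ ≠ a₂ → a₁ ≠ a₃ → a₂ ≠ a₃ → o ≠ a₁ → o ≠ a₂ → o ≠ a₃ → b ≠ a₁ → b ≠ a₂ → b ≠ a₃ → o ≠ b → (prodBernoulli w).real (openConn a₃ b) ≤ (prodBernoulli w).real (openConn a₁ b) → (prodBernoulli w).real (openConn a₃ b) ≤ (prodBernoulli w).real (openConn a₂ b) → ((prodBernoulli w).real ((openConn a₁ a₂)ᶜ ∩ (openConn a₁ a₃)ᶜ ∩ (openConn a₂ a₃)ᶜ ∩ openConn a₁ o) + (prodBernoulli w).real ((openConn a₁ a₂)ᶜ ∩ (openConn a₁ a₃)ᶜ ∩ (openConn a₂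 a₃)ᶜ ∩ openConn a₂ o)) * ((prodBernoulli w).real ((openConn a₁ a₃)ᶜ ∩ (openConn a₂ a₃)ᶜ ∩ (openConn a₁ b ∩ openConn a₂ b)) - (prodBernoulli w).real ((openConn a₁ a₃)ᶜ ∩ (openConn a₂ a₃)ᶜ ∩ openConn a₃ b)) ≤ (prodBernoulli w).real ((openConn a₁ a₂)ᶜ ∩ (openConn a₁ a₃)ᶜ ∩ (openConn a₂ a₃)ᶜ : Set (BondConfig (Fin n))) * ((prodBernoulli w).real ((openConn a₁ a₃)ᶜ ∩ (openConn a₂ a₃)ᶜ ∩ ((openConn a₁ o ∪ openConn a₂ o) ∩ (openConn a₁ b ∩ openConn a₂ b))) - (prodBernoulli w).real ((openConn a₁ a₃)ᶜ ∩ (openConn a₂ a₃)ᶜ ∩ ((openConn a₁ o ∪ openConn a₂ o) ∩ openConn a₃ b))))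
    (hXi : ∀ (n : ℕ) (w : Sym2 (Fin n) → unitInterval) (o b a₁ a₂ a₃ : Fin n), a₁ ≠ a₂ → a₁ ≠ a₃ → a₂ ≠ a₃ → o ≠ a₁ → o ≠ a₂ → o ≠ a₃ → b ≠ a₁ → b ≠ a₂ → b ≠ a₃ → o ≠ b → ((prodBernoulli w).real ((openConn a₁ a₂)ᶜ ∩ (openConn a₁ a₃)ᶜ : Set (BondConfig (Fin n))) * (prodBernoulli w).real ((openConn a₁ a₂)ᶜ ∩ (openConn a₁ a₃)ᶜ ∩ (openConn a₂ a₃)ᶜ ∩ openConn a₁ o) - (prodBernoulli w).real ((openConn a₁ a₂)ᶜ ∩ (openConn a₁ a₃)ᶜ ∩ (openConn a₂ a₃)ᶜ : Set (BondConfig (Fin n))) * (prodBernoulli w).real ((openConn a₁ a₂)ᶜ ∩ (openConn a₁ a₃)ᶜ ∩ openConn a₁ o)) * min ((prodBernoulli w).real ((openConn a₁ a₂)ᶜ ∩ (openConn a₁ a₃)ᶜ ∩ (openConn a₂ a₃)ᶜ ∩ openConn a₂ b)) ((prodBernoulli w).real ((openConn a₁ a₂)ᶜ ∩ (openConn a₁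 a₃)ᶜ ∩ (openConn a₂ a₃)ᶜ ∩ openConn a₃ b)) ≤ (prodBernoulli w).real ((openConn a₁ a₂)ᶜ ∩ (openConn a₁ a₃)ᶜ ∩ (openConn a₂ a₃)ᶜ : Set (BondConfig (Fin n))) * ((prodBernoulli w).real ((openConn a₁ a₂)ᶜ ∩ (openConn a₁ a₃)ᶜ ∩ openConn a₁ o) * (prodBernoulli w).real ((openConn a₁ a₂)ᶜ ∩ (openConn a₁ a₃)ᶜ ∩ (openConn a₂ b ∩ openConn a₃ b)) - (prodBernoulli w).real ((openConn a₁ a₂)ᶜ ∩ (openConn a₁ a₃)ᶜ : Set (BondConfig (Fin n))) * (prodBernoulli w).real ((openConn a₁ a₂)ᶜ ∩ (openConn a₁ a₃)ᶜ ∩ (openConn a₁ o ∩ (openConn a₂ b ∩ openConn a₃ b)))))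
    {n : ℕ} (w : Sym2 (Fin n) → unitInterval) (o b a₁ a₂ a₃ : Fin n)
    (h12 : a₁ ≠ a₂) (h13 : a₁ ≠ a₃) (h23 : a₂ ≠ a₃) (ho1 : o ≠ a₁) (ho2 : o ≠ a₂) (ho3 : o ≠ a₃)
    (hb1 : b ≠ a₁) (hb2 : b ≠ a₂) (hb3 : b ≠ a₃) (hob : o ≠ b)
    (hM : 0 < (prodBernoulli w).real ((openConn a₁ a₂)ᶜ ∩ (openConn a₁ a₃)ᶜ ∩ (openConn a₂ a₃)ᶜ : Set (BondConfig (Fin n))))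
    (hτ₁ : (prodBernoulli w).real (openConn a₃ b) ≤ (prodBernoulli w).real (openConn a₁ b))
    (hτ₂ : (prodBernoulli w).real (openConn a₃ b) ≤ (prodBernoulli w).real (openConn a₂ b)) :
    (prodBernoulli w).real ((openConn o a₁ ∪ openConn o a₂ ∪ openConn o a₃) ∩ openConn a₃ b) ≤
      (prodBernoulli w).real ((openConn o a₁ ∪ openConn o a₂ ∪ openConn o a₃) ∩ openConn o b) := by
  have x1 := sigmaMin_of_xiMin w o b a₁ a₂ a₃ h12 h13 (hXi n w o b a₁ a₂ a₃ h12 h13 h23 ho1 ho2 ho3 hb1 hb2 hb3 hob)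
  have x2 := sigmaMin_of_xiMin w o b a₂ a₁ a₃ h12.symm h23 (hXi n w o b a₂ a₁ a₃ h12.symm h23 h13 ho2 ho1 ho3 hb2 hb1 hb3 hob)
  have eM : ((openConn a₂ a₁)ᶜ ∩ (openConn a₂ a₃)ᶜ ∩ (openConn a₁ a₃)ᶜ : Set (BondConfig (Fin n))) =
      (openConn a₁ a₂)ᶜ ∩ (openConn a₁ a₃)ᶜ ∩ (openConn a₂ a₃)ᶜ := by
    rw [knThm2_openConn_comm a₂ a₁, Set.inter_assoc, Set.inter_comm ((openConn a₂ a₃)ᶜ), ← Set.inter_assoc]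
  rw [eM] at x2
  exact preFKG3_of_claimI_sigmaMin w o b a₁ a₂ a₃ h12 h13 h23 hM hτ₁ hτ₂
    (hI n w o b a₁ a₂ a₃ h12 h13 h23 ho1 ho2 ho3 hb1 hb2 hb3 hob hτ₁ hτ₂) x1 x2

end

end Summit.CriticalPhenomena.PercolationContinuityZ3.Theorems
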